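import Summits.HodgeConjecture.HodgeConjecture.Theorems.R90S6HyperbolicHeckeFLClosed        -- ★ B2d CLOSED p864596: the socket vocabulary (`IsLocalDeltaTransfer`, `finExplicitCollection`, canonical families, Hecke coefficients)
import Summits.HodgeConjecture.HodgeConjecture.Theorems.R90S6HeckeCoeffIndepCMTwo           -- ★ W9-A.6 p863456 `coeff_toVector_comp_eq_of_memLaw_cm_two` («EH-SWAP», cited in the docstrings)
import Summits.HodgeConjecture.HodgeConjecture.Theorems.R90S6SocketFrameDossier            -- ★ (G4) p865118: «SBAD-FIN» ∕ «FRAME RECIPE» ∕ «EH-SWAP» (the assembler's `Sbad`, `eG`, `e₂`; cited)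
import Summits.HodgeConjecture.HodgeConjecture.Theorems.R90S6EllipticOrbitalTransport       -- ★ T-ELL p865007 (the elliptic payers' transport; cited)
import Summits.HodgeConjecture.HodgeConjecture.Theorems.R90S6CompactFactorOrbitalDrop       -- ★ U1B p864945 (the `H`-side compact-factor drop; cited)
import HarnessLib

/-!
# R90 · S6 «Ch. 14.1–14.5 stable trace formula» — (G5) FILE (A): `HeckeFLAtFrame` FROM «EH-SWAP», «CLASSIFY» AND THE THREE CELL PAYERS
# (`Theorems/R90S6HeckeFLAtFrameOfCells.lean`; DAG r29 row E1.3.9 «the socket assembly itself»)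

Cell `hodgecm-mathlib`, crux H413 (`stmt-HodgeConjecture-24833`), route of record `HCCMUnconditional`; programme R90-TF, section S6 (base `R90-C14`), seat K2E3-p34 (g3),
card «G5-SCRATCH» → FILE (A) (S6 dealer R90-C14-plan (g2) 2026-09-05T03:22:33Z + (g3) RULINGS #1 (R8) 03:36:32Z + #21 (R57) 03:56:28Z «FILE (A) NOW»; spec authority typ2 (g3):
T2-ASM census `R90/R90-C14-typ2/g3/S6_E139_AssemblyCensus.v1.md` 15fbf54ecafd8538 §3 row E1.3.9 + LETTER-FIT (P1)–(P4) 03:35:05Z ∕ 03:57:29Z; binder census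
`K2/K2E3-p34/g3/CENSUS-G5-HeckeFLAtFrame-binders.md` 13a01909facdb4ba; HOME scratch ED. B a7e91e93d11cabfa with the fit test `example : StubR90ExtE1HeckeFLOneFrame`).
Lane `--kind proof --supports stmt-HodgeConjecture-24833 --as helper`; THEOREMS ONLY (no definition, no instance, no notation, no named fact, no `sorry`; default heartbeats);
imports ★ Theorems only (never `Cruxes/…/Lines`).

## What this file proves

The ONE-FRAME body of the floor text `StubR90ExtE1HeckeFL` (`Cruxes/H413/Lines/R90_S6_FloorE1D.lean` :250; one-frame edition `StubR90ExtE1HeckeFLOneFrame` :989, per-place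
body `HeckeFLAtFrame` :901) — «for every `H`-transport `eH` with the K-law, all CANONICAL orbital-measure families `mH, mG`, and every Satake-graph pair `(φ, φH)`,
`h ↦ φH(eH h.1)` is a `Δ‴_v`-transfer of `g ↦ φ(eG g)`» — at ONE place `(v, w)` and ONE `G`-transport `eG`, FROM:
* «EH-SWAP» `hSWAP`: every K-law₂ frame `eH` gives the SAME `H`-test function as a fixed frame `e₂` (supplied by ★ (G4) §6 `heckeTestFun_eq_of_memLaw_two` ⇐ ★ W9-A.6);
* «CLASSIFY» `hCLASSIFY`: every `G`-regular `γ_H ∈ H_v` lies in one of three cells `IsHypCell ∕ IsEllOneCell ∕ IsEllTwoCell` (predicates are PARAMETERS; the CLASSIFY bricks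
  ★ C0 `R90S6GRegularCellsU2Hyp` → C1 → C2 → C3 (K2E3-p11) fix their currency and prove the trichotomy);
* the three CELL PAYERS `hHYP hELL1 hELL2`: the clause of ★ `isLocalDeltaTransfer_iff` (= `Iff.rfl`) at every `G`-regular `γ_H` of the cell, for the test functions at
  `(e₂, eG)` (payer files: `…AtFrameHypCell` ⇐ ★ B2d CLOSED + ★ (G4); `…AtFrameEllOneCell` ⇐ (E1) + ★ T-ELL + ★ U1B; `…AtFrameEllTwoCell` ⇐ (E2)).
Binders = `HeckeFLAtFrame`'s (D :901–:917) with the measurable structures and Haar measures taken PER PLACE at `v` (`[MeasurableSpace H_v] … (νHv : Measure H_v)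
(νGv : Measure G′_v) …` after `(v w hw hv)`; dealer (g3) RULINGS #40 (R92); the socket's families instantiate them as `(νH v) (νG v)`, S10's per-place letter (DEAL #106) binds them directly —
R90-C138-p07 (g2) census 617d00ea5f015022 (α)); then four instance-GENERIC Borel structures on the centraliser quotients (★ B2d CLOSED's
spelling; the socket's `letI … borel _ ∕ haveI … ⟨rfl⟩` instantiate them); the CONCLUSION is D :1047–:1064 with D's two shorthand defs UNFOLDED (`heckeToFun K T g` =
`(heckeAlgebra.toVector K T).coeff ↑g`, `SatakeGraph … φ φH` = `∀ z, λ^{(2)}_{(z,1)}(φH) = λ^{(3)}_{(−z,1,1)}(φ)`, both `rfl`), so D ED. 6 links it by the zero-binder pattern of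
D :1080.  PROOF: introduce `eH` and `γ_H` (unfolding `IsLocalDeltaTransfer`), move the `H`-side to `e₂` by `congrArg` along `hSWAP`, classify `γ_H`, apply the payer — 12 lines.
HONEST LABEL: a COMBINATOR — it pays socket :989 only together with the three cell payers + C3 + D ED. 6; count-neutral helper until then; HC_CM is proved only modulo the
7 printed citations (2 remaining named inputs: hLiu418 = stmt-HodgeConjecture-24832, h413 = stmt-HodgeConjecture-24833) until rung 0 closes; REL ≠ ★ ≠ BUILT.

## References
* [Rogawski1990] J. D. Rogawski, *Automorphic Representations of Unitary Groups in Three Variables*, Ann. of Math. Stud. 123 (1990), §4.3 (4.3.1) p. 43; §4.9 Prop. 4.9.1 (b),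
  (4.9.2), Lemma 4.9.2 pp. 54–56; §14.2 p. 233.
* [CartierCorvallis1979] P. Cartier, *Representations of p-adic groups: a survey*, PSPM 33.1 (1979), §IV.1 (4.2)–(4.4).
-/

set_option autoImplicit false
-- the mandated namespace repeats the single-problem summit's segment (`HodgeConjecture.HodgeConjecture`)
set_option linter.dupNamespace false

noncomputable section

open MeasureTheory Measure NumberField IsDedekindDomain
open Literature.NumberTheory.Automorphic Literature.NumberTheory.Automorphic.UnitaryGroup
open Literature.NumberTheory.Automorphic.HermitianLattice Literature.NumberTheory.GaloisRepresentations
open Literature.NumberTheory.Rogawski1990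
open scoped Matrix MatrixGroups

namespace Summit.HodgeConjecture.HodgeConjecture.R90.S6

/-- **(G5) FILE (A) — THE ONE-FRAME BODY OF THE HECKE-ALGEBRA FUNDAMENTAL LEMMA (`HeckeFLAtFrame`, Satake-graph form at `Δ‴_v`) FROM «EH-SWAP», «CLASSIFY» AND THE
THREE CELL PAYERS.**  At a finite place `v` of `L⁺` with `w ∣ v` fixed by `c` and `v` unramified in `L`, for a `G`-transport `eG : U(H′)(L⁺_v) ≃ₜ* U(σ_w, J₀,3)(L_w)`:
given a fixed `H`-transport `e₂ : U(Φ₂)(L⁺_v) ≃ₜ* U(σ_w, J₀,2)(L_w)` such that EVERY `H`-transport `eH` with the K-law `eH h ∈ U(J₀,2)(𝒪_w) ↔ h ∈ U(Φ₂)(𝒪_v)` yields the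
same test function `h ↦ φH(eH h.1)` as `e₂` (`hSWAP` — Cartier's bi-`K₀`-invariance, ★ W9-A.6), three predicates `IsHypCell, IsEllOneCell, IsEllTwoCell` on `H_v = U(Φ₂)_v × U(Φ₁)_v`
exhausting the `G`-regular elements (`hCLASSIFY`), and for each cell the identity (4.3.1) «`Φ^st(γ_H, φH ∘ e₂ ∘ fst) = ∑ᶠ c, Δ‴_v(γ_H, out c) · Φ(c, φ ∘ eG)`» at every `G`-regular
`γ_H` of the cell, for all canonical families `mH, mG` and all pairs `(φ, φH)` with `λ^{(2)}_{(z,1)}(φH) = λ^{(3)}_{(−z,1,1)}(φ)` (`hHYP hELL1 hELL2`) — THEN for every `eH` with the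
K-law, all canonical `mH, mG` and all Satake-graph pairs, `h ↦ φH(eH h.1)` is a `Δ‴_v`-transfer of `g ↦ φ(eG g)` (★ `IsLocalDeltaTransfer`).  Binders are the floor text's
(`HeckeFLAtFrame`) with measures∕structures PER PLACE at `v`; the conclusion is its body (defs unfolded); proof = `congrArg` along `hSWAP` + ★ `isLocalDeltaTransfer_iff` (`Iff.rfl`) + case split.
[cite: Rogawski1990, §4.9 Prop. 4.9.1 (b) pp. 55–56; §4.3 (4.3.1) p. 43] [cite: CartierCorvallis1979, §IV.1 (4.2)–(4.4)] -/
theorem heckeFLAtFrame_of_cells (L : Type) [Field L] [NumberField L] [IsCMField L] (H' : Matrix (Fin 3) (Fin 3) L) (μ : HeckeCharacter L)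
    -- PER-PLACE measurable structures and Haar measures at `v` (the socket's families instantiate them at `v`: `νHv := νH v`, `νGv := νG v`, instances by synthesis)
    (v : HeightOneSpectrum (𝓞 ↥(maximalRealSubfield L))) (w : UnitaryGroup.PlacesOver L v) (hw : IsCMField.complexConj L • w.1 = w.1)
    (hv : Algebra.IsUnramifiedIn (𝓞 L) v.asIdeal)
    [MeasurableSpace ((UnitaryGroup.cmDatum L 2 (Matrix.of fun i j : Fin 2 => if i.val + j.val + 1 = 2 then (1 : L) else 0)).Local v ×
        (UnitaryGroup.cmDatum L 1 (Matrix.of fun i j : Fin 1 => if i.val + j.val + 1 = 1 then (1 : L) else 0)).Local v)]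
    [BorelSpace ((UnitaryGroup.cmDatum L 2 (Matrix.of fun i j : Fin 2 => if i.val + j.val + 1 = 2 then (1 : L) else 0)).Local v ×
        (UnitaryGroup.cmDatum L 1 (Matrix.of fun i j : Fin 1 => if i.val + j.val + 1 = 1 then (1 : L) else 0)).Local v)]
    [MeasurableSpace ((UnitaryGroup.cmDatum L 3 H').Local v)] [BorelSpace ((UnitaryGroup.cmDatum L 3 H').Local v)]
    (νHv : Measure ((UnitaryGroup.cmDatum L 2 (Matrix.of fun i j : Fin 2 => if i.val + j.val + 1 = 2 then (1 : L) else 0)).Local v ×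
        (UnitaryGroup.cmDatum L 1 (Matrix.of fun i j : Fin 1 => if i.val + j.val + 1 = 1 then (1 : L) else 0)).Local v))
    (νGv : Measure ((UnitaryGroup.cmDatum L 3 H').Local v))
    [νHv.IsHaarMeasure] [νHv.IsMulRightInvariant] [νGv.IsHaarMeasure] [νGv.IsMulRightInvariant]
    (eG : (UnitaryGroup.cmDatum L 3 H').Local v ≃ₜ* ↥(unitaryGroupOfForm (galAdicCompletionMap (L := L) (IsCMField.complexConj L) hw) ((StdForm.antidiagonal 3).over (w.1.adicCompletion L))))
    -- Borel structures on the centraliser quotients, instance-GENERIC (★ B2d CLOSED's spelling; the socket instantiates them at `borel _ ∕ ⟨rfl⟩`)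
    [∀ a : ((UnitaryGroup.cmDatum L 2 (Matrix.of fun i j : Fin 2 => if i.val + j.val + 1 = 2 then (1 : L) else 0)).Local v ×
        (UnitaryGroup.cmDatum L 1 (Matrix.of fun i j : Fin 1 => if i.val + j.val + 1 = 1 then (1 : L) else 0)).Local v),
      MeasurableSpace (((UnitaryGroup.cmDatum L 2 (Matrix.of fun i j : Fin 2 => if i.val + j.val + 1 = 2 then (1 : L) else 0)).Local v ×
        (UnitaryGroup.cmDatum L 1 (Matrix.of fun i j : Fin 1 => if i.val + j.val + 1 = 1 then (1 : L) else 0)).Local v) ⧸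
        Subgroup.centralizer ({a} : Set ((UnitaryGroup.cmDatum L 2 (Matrix.of fun i j : Fin 2 => if i.val + j.val + 1 = 2 then (1 : L) else 0)).Local v ×
        (UnitaryGroup.cmDatum L 1 (Matrix.of fun i j : Fin 1 => if i.val + j.val + 1 = 1 then (1 : L) else 0)).Local v)))]
    [∀ a : ((UnitaryGroup.cmDatum L 2 (Matrix.of fun i j : Fin 2 => if i.val + j.val + 1 = 2 then (1 : L) else 0)).Local v ×
        (UnitaryGroup.cmDatum L 1 (Matrix.of fun i j : Fin 1 => if i.val + j.val + 1 = 1 then (1 : L) else 0)).Local v),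
      BorelSpace (((UnitaryGroup.cmDatum L 2 (Matrix.of fun i j : Fin 2 => if i.val + j.val + 1 = 2 then (1 : L) else 0)).Local v ×
        (UnitaryGroup.cmDatum L 1 (Matrix.of fun i j : Fin 1 => if i.val + j.val + 1 = 1 then (1 : L) else 0)).Local v) ⧸
        Subgroup.centralizer ({a} : Set ((UnitaryGroup.cmDatum L 2 (Matrix.of fun i j : Fin 2 => if i.val + j.val + 1 = 2 then (1 : L) else 0)).Local v ×
        (UnitaryGroup.cmDatum L 1 (Matrix.of fun i j : Fin 1 => if i.val + j.val + 1 = 1 then (1 : L) else 0)).Local v)))]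
    [∀ γ : (UnitaryGroup.cmDatum L 3 H').Local v,
      MeasurableSpace ((UnitaryGroup.cmDatum L 3 H').Local v ⧸ Subgroup.centralizer ({γ} : Set ((UnitaryGroup.cmDatum L 3 H').Local v)))]
    [∀ γ : (UnitaryGroup.cmDatum L 3 H').Local v,
      BorelSpace ((UnitaryGroup.cmDatum L 3 H').Local v ⧸ Subgroup.centralizer ({γ} : Set ((UnitaryGroup.cmDatum L 3 H').Local v)))]
    -- a fixed `H`-transport (the assembler takes ★ (F.2) at `N = 2` = ★ (G4) §5 `exists_socketFrame_two`)
    (e₂ : (UnitaryGroup.cmDatum L 2 (Matrix.of fun i j : Fin 2 => if i.val + j.val + 1 = 2 then (1 : L) else 0)).Local v ≃ₜ*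
      ↥(unitaryGroupOfForm (galAdicCompletionMap (L := L) (IsCMField.complexConj L) hw) ((StdForm.antidiagonal 2).over (w.1.adicCompletion L))))
    -- «EH-SWAP» (★ (G4) §6 `heckeTestFun_eq_of_memLaw_two` ⇐ ★ W9-A.6 `coeff_toVector_comp_eq_of_memLaw_cm_two`)
    (hSWAP : ∀ eH : (UnitaryGroup.cmDatum L 2 (Matrix.of fun i j : Fin 2 => if i.val + j.val + 1 = 2 then (1 : L) else 0)).Local v ≃ₜ*
          ↥(unitaryGroupOfForm (galAdicCompletionMap (L := L) (IsCMField.complexConj L) hw) ((StdForm.antidiagonal 2).over (w.1.adicCompletion L))),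
        (∀ h : (UnitaryGroup.cmDatum L 2 (Matrix.of fun i j : Fin 2 => if i.val + j.val + 1 = 2 then (1 : L) else 0)).Local v,
          eH h ∈ unitaryInt (galAdicCompletionMap (L := L) (IsCMField.complexConj L) hw) ((StdForm.antidiagonal 2).over (w.1.adicCompletion L)) ↔
            h ∈ UnitaryGroup.cmLocalIntegralLevel L 2 (Matrix.of fun i j : Fin 2 => if i.val + j.val + 1 = 2 then (1 : L) else 0) v) →
        ∀ φH : heckeAlgebra ℂ ↥(unitaryGroupOfForm (galAdicCompletionMap (L := L) (IsCMField.complexConj L) hw) ((StdForm.antidiagonal 2).over (w.1.adicCompletion L)))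
            (unitaryInt (galAdicCompletionMap (L := L) (IsCMField.complexConj L) hw) ((StdForm.antidiagonal 2).over (w.1.adicCompletion L))),
          (fun h : (UnitaryGroup.cmDatum L 2 (Matrix.of fun i j : Fin 2 => if i.val + j.val + 1 = 2 then (1 : L) else 0)).Local v ×
        (UnitaryGroup.cmDatum L 1 (Matrix.of fun i j : Fin 1 => if i.val + j.val + 1 = 1 then (1 : L) else 0)).Local v =>
              (heckeAlgebra.toVector (unitaryInt (galAdicCompletionMap (L := L) (IsCMField.complexConj L) hw) ((StdForm.antidiagonal 2).over (w.1.adicCompletion L))) φH).coeff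
                (((eH h.1 : ↥(unitaryGroupOfForm (galAdicCompletionMap (L := L) (IsCMField.complexConj L) hw) ((StdForm.antidiagonal 2).over (w.1.adicCompletion L))))) : ↥(unitaryGroupOfForm (galAdicCompletionMap (L := L) (IsCMField.complexConj L) hw) ((StdForm.antidiagonal 2).over (w.1.adicCompletion L))) ⧸
                  unitaryInt (galAdicCompletionMap (L := L) (IsCMField.complexConj L) hw) ((StdForm.antidiagonal 2).over (w.1.adicCompletion L)))) =
          (fun h : (UnitaryGroup.cmDatum L 2 (Matrix.of fun i j : Fin 2 => if i.val + j.val + 1 = 2 then (1 : L) else 0)).Local v ×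
        (UnitaryGroup.cmDatum L 1 (Matrix.of fun i j : Fin 1 => if i.val + j.val + 1 = 1 then (1 : L) else 0)).Local v =>
              (heckeAlgebra.toVector (unitaryInt (galAdicCompletionMap (L := L) (IsCMField.complexConj L) hw) ((StdForm.antidiagonal 2).over (w.1.adicCompletion L))) φH).coeff
                (((e₂ h.1 : ↥(unitaryGroupOfForm (galAdicCompletionMap (L := L) (IsCMField.complexConj L) hw) ((StdForm.antidiagonal 2).over (w.1.adicCompletion L))))) : ↥(unitaryGroupOfForm (galAdicCompletionMap (L := L) (IsCMField.complexConj L) hw) ((StdForm.antidiagonal 2).over (w.1.adicCompletion L))) ⧸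
                  unitaryInt (galAdicCompletionMap (L := L) (IsCMField.complexConj L) hw) ((StdForm.antidiagonal 2).over (w.1.adicCompletion L)))))
    -- «CLASSIFY»: the three cells of `G`-regular `γ_H` (currency fixed by the CLASSIFY bricks C0–C3)
    (IsHypCell IsEllOneCell IsEllTwoCell : ((UnitaryGroup.cmDatum L 2 (Matrix.of fun i j : Fin 2 => if i.val + j.val + 1 = 2 then (1 : L) else 0)).Local v ×
        (UnitaryGroup.cmDatum L 1 (Matrix.of fun i j : Fin 1 => if i.val + j.val + 1 = 1 then (1 : L) else 0)).Local v) → Prop)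
    (hCLASSIFY : ∀ γH : ((UnitaryGroup.cmDatum L 2 (Matrix.of fun i j : Fin 2 => if i.val + j.val + 1 = 2 then (1 : L) else 0)).Local v ×
        (UnitaryGroup.cmDatum L 1 (Matrix.of fun i j : Fin 1 => if i.val + j.val + 1 = 1 then (1 : L) else 0)).Local v),
      IsLocalGRegular L v γH → IsHypCell γH ∨ IsEllOneCell γH ∨ IsEllTwoCell γH)
    -- the three cell payers at the frames `(eG, e₂)`, in ★ `isLocalDeltaTransfer_iff` letters
    (hHYP : ∀ (mH : OrbitalMeasureFamily ((UnitaryGroup.cmDatum L 2 (Matrix.of fun i j : Fin 2 => if i.val + j.val + 1 = 2 then (1 : L) else 0)).Local v ×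
        (UnitaryGroup.cmDatum L 1 (Matrix.of fun i j : Fin 1 => if i.val + j.val + 1 = 1 then (1 : L) else 0)).Local v))
        (mG : OrbitalMeasureFamily ((UnitaryGroup.cmDatum L 3 H').Local v)),
        mH.IsCanonical (IsLocalGRegular L v) νHv →
          mG.IsCanonical (fun γ => IsRegularElt (γ.val : GL (Fin 3) (UnitaryGroup.LocalRing L v))) νGv →
            ∀ (φ : heckeAlgebra ℂ ↥(unitaryGroupOfForm (galAdicCompletionMap (L := L) (IsCMField.complexConj L) hw) ((StdForm.antidiagonal 3).over (w.1.adicCompletion L)))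
                (unitaryInt (galAdicCompletionMap (L := L) (IsCMField.complexConj L) hw) ((StdForm.antidiagonal 3).over (w.1.adicCompletion L))))
              (φH : heckeAlgebra ℂ ↥(unitaryGroupOfForm (galAdicCompletionMap (L := L) (IsCMField.complexConj L) hw) ((StdForm.antidiagonal 2).over (w.1.adicCompletion L)))
                (unitaryInt (galAdicCompletionMap (L := L) (IsCMField.complexConj L) hw) ((StdForm.antidiagonal 2).over (w.1.adicCompletion L)))),
            (∀ z : ℂˣ,
            UnitaryGroup.unitaryHeckeEigencharacterAdic (IsCMField.complexConj L) (IsCMField.complexConj_ne_one L) v w hw hv ![z, 1] φH =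
              UnitaryGroup.unitaryHeckeEigencharacterAdic (IsCMField.complexConj L) (IsCMField.complexConj_ne_one L) v w hw hv ![-z, 1, 1] φ) →
              ∀ γH : ((UnitaryGroup.cmDatum L 2 (Matrix.of fun i j : Fin 2 => if i.val + j.val + 1 = 2 then (1 : L) else 0)).Local v ×
        (UnitaryGroup.cmDatum L 1 (Matrix.of fun i j : Fin 1 => if i.val + j.val + 1 = 1 then (1 : L) else 0)).Local v),
                IsLocalGRegular L v γH → IsHypCell γH →
                  stableOrbitalIntegralRel (IsLocalStablyConjH L v) mH
                    (fun h : (UnitaryGroup.cmDatum L 2 (Matrix.of fun i j : Fin 2 => if i.val + j.val + 1 = 2 then (1 : L) else 0)).Local v ×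
        (UnitaryGroup.cmDatum L 1 (Matrix.of fun i j : Fin 1 => if i.val + j.val + 1 = 1 then (1 : L) else 0)).Local v =>
              (heckeAlgebra.toVector (unitaryInt (galAdicCompletionMap (L := L) (IsCMField.complexConj L) hw) ((StdForm.antidiagonal 2).over (w.1.adicCompletion L))) φH).coeff
                (((e₂ h.1 : ↥(unitaryGroupOfForm (galAdicCompletionMap (L := L) (IsCMField.complexConj L) hw) ((StdForm.antidiagonal 2).over (w.1.adicCompletion L))))) : ↥(unitaryGroupOfForm (galAdicCompletionMap (L := L) (IsCMField.complexConj L) hw) ((StdForm.antidiagonal 2).over (w.1.adicCompletion L))) ⧸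
                  unitaryInt (galAdicCompletionMap (L := L) (IsCMField.complexConj L) hw) ((StdForm.antidiagonal 2).over (w.1.adicCompletion L)))) γH =
                  ∑ᶠ c : ConjClasses ((UnitaryGroup.cmDatum L 3 H').Local v),
                    ((finExplicitCollection L H' μ (finExplicitDelta_conj_left_all L H' μ) (finExplicitDelta_conj_right_all L H' μ)) v).Δ γH (Quotient.out c) *
                      classOrbitalIntegral mG
                        (fun g : (UnitaryGroup.cmDatum L 3 H').Local v =>
              (heckeAlgebra.toVector (unitaryInt (galAdicCompletionMap (L := L) (IsCMField.complexConj L) hw) ((StdForm.antidiagonal 3).over (w.1.adicCompletion L))) φ).coeff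
                (((eG g : ↥(unitaryGroupOfForm (galAdicCompletionMap (L := L) (IsCMField.complexConj L) hw) ((StdForm.antidiagonal 3).over (w.1.adicCompletion L))))) : ↥(unitaryGroupOfForm (galAdicCompletionMap (L := L) (IsCMField.complexConj L) hw) ((StdForm.antidiagonal 3).over (w.1.adicCompletion L))) ⧸
                  unitaryInt (galAdicCompletionMap (L := L) (IsCMField.complexConj L) hw) ((StdForm.antidiagonal 3).over (w.1.adicCompletion L)))) c)
    (hELL1 : ∀ (mH : OrbitalMeasureFamily ((UnitaryGroup.cmDatum L 2 (Matrix.of fun i j : Fin 2 => if i.val + j.val + 1 = 2 then (1 : L) else 0)).Local v ×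
        (UnitaryGroup.cmDatum L 1 (Matrix.of fun i j : Fin 1 => if i.val + j.val + 1 = 1 then (1 : L) else 0)).Local v))
        (mG : OrbitalMeasureFamily ((UnitaryGroup.cmDatum L 3 H').Local v)),
        mH.IsCanonical (IsLocalGRegular L v) νHv →
          mG.IsCanonical (fun γ => IsRegularElt (γ.val : GL (Fin 3) (UnitaryGroup.LocalRing L v))) νGv →
            ∀ (φ : heckeAlgebra ℂ ↥(unitaryGroupOfForm (galAdicCompletionMap (L := L) (IsCMField.complexConj L) hw) ((StdForm.antidiagonal 3).over (w.1.adicCompletion L)))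
                (unitaryInt (galAdicCompletionMap (L := L) (IsCMField.complexConj L) hw) ((StdForm.antidiagonal 3).over (w.1.adicCompletion L))))
              (φH : heckeAlgebra ℂ ↥(unitaryGroupOfForm (galAdicCompletionMap (L := L) (IsCMField.complexConj L) hw) ((StdForm.antidiagonal 2).over (w.1.adicCompletion L)))
                (unitaryInt (galAdicCompletionMap (L := L) (IsCMField.complexConj L) hw) ((StdForm.antidiagonal 2).over (w.1.adicCompletion L)))),
            (∀ z : ℂˣ,
            UnitaryGroup.unitaryHeckeEigencharacterAdic (IsCMField.complexConj L) (IsCMField.complexConj_ne_one L) v w hw hv ![z, 1] φH =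
              UnitaryGroup.unitaryHeckeEigencharacterAdic (IsCMField.complexConj L) (IsCMField.complexConj_ne_one L) v w hw hv ![-z, 1, 1] φ) →
              ∀ γH : ((UnitaryGroup.cmDatum L 2 (Matrix.of fun i j : Fin 2 => if i.val + j.val + 1 = 2 then (1 : L) else 0)).Local v ×
        (UnitaryGroup.cmDatum L 1 (Matrix.of fun i j : Fin 1 => if i.val + j.val + 1 = 1 then (1 : L) else 0)).Local v),
                IsLocalGRegular L v γH → IsEllOneCell γH →
                  stableOrbitalIntegralRel (IsLocalStablyConjH L v) mH
                    (fun h : (UnitaryGroup.cmDatum L 2 (Matrix.of fun i j : Fin 2 => if i.val + j.val + 1 = 2 then (1 : L) else 0)).Local v ×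
        (UnitaryGroup.cmDatum L 1 (Matrix.of fun i j : Fin 1 => if i.val + j.val + 1 = 1 then (1 : L) else 0)).Local v =>
              (heckeAlgebra.toVector (unitaryInt (galAdicCompletionMap (L := L) (IsCMField.complexConj L) hw) ((StdForm.antidiagonal 2).over (w.1.adicCompletion L))) φH).coeff
                (((e₂ h.1 : ↥(unitaryGroupOfForm (galAdicCompletionMap (L := L) (IsCMField.complexConj L) hw) ((StdForm.antidiagonal 2).over (w.1.adicCompletion L))))) : ↥(unitaryGroupOfForm (galAdicCompletionMap (L := L) (IsCMField.complexConj L) hw) ((StdForm.antidiagonal 2).over (w.1.adicCompletion L))) ⧸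
                  unitaryInt (galAdicCompletionMap (L := L) (IsCMField.complexConj L) hw) ((StdForm.antidiagonal 2).over (w.1.adicCompletion L)))) γH =
                  ∑ᶠ c : ConjClasses ((UnitaryGroup.cmDatum L 3 H').Local v),
                    ((finExplicitCollection L H' μ (finExplicitDelta_conj_left_all L H' μ) (finExplicitDelta_conj_right_all L H' μ)) v).Δ γH (Quotient.out c) *
                      classOrbitalIntegral mG
                        (fun g : (UnitaryGroup.cmDatum L 3 H').Local v =>
              (heckeAlgebra.toVector (unitaryInt (galAdicCompletionMap (L := L) (IsCMField.complexConj L) hw) ((StdForm.antidiagonal 3).over (w.1.adicCompletion L))) φ).coeff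
                (((eG g : ↥(unitaryGroupOfForm (galAdicCompletionMap (L := L) (IsCMField.complexConj L) hw) ((StdForm.antidiagonal 3).over (w.1.adicCompletion L))))) : ↥(unitaryGroupOfForm (galAdicCompletionMap (L := L) (IsCMField.complexConj L) hw) ((StdForm.antidiagonal 3).over (w.1.adicCompletion L))) ⧸
                  unitaryInt (galAdicCompletionMap (L := L) (IsCMField.complexConj L) hw) ((StdForm.antidiagonal 3).over (w.1.adicCompletion L)))) c)
    (hELL2 : ∀ (mH : OrbitalMeasureFamily ((UnitaryGroup.cmDatum L 2 (Matrix.of fun i j : Fin 2 => if i.val + j.val + 1 = 2 then (1 : L) else 0)).Local v ×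
        (UnitaryGroup.cmDatum L 1 (Matrix.of fun i j : Fin 1 => if i.val + j.val + 1 = 1 then (1 : L) else 0)).Local v))
        (mG : OrbitalMeasureFamily ((UnitaryGroup.cmDatum L 3 H').Local v)),
        mH.IsCanonical (IsLocalGRegular L v) νHv →
          mG.IsCanonical (fun γ => IsRegularElt (γ.val : GL (Fin 3) (UnitaryGroup.LocalRing L v))) νGv →
            ∀ (φ : heckeAlgebra ℂ ↥(unitaryGroupOfForm (galAdicCompletionMap (L := L) (IsCMField.complexConj L) hw) ((StdForm.antidiagonal 3).over (w.1.adicCompletion L)))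
                (unitaryInt (galAdicCompletionMap (L := L) (IsCMField.complexConj L) hw) ((StdForm.antidiagonal 3).over (w.1.adicCompletion L))))
              (φH : heckeAlgebra ℂ ↥(unitaryGroupOfForm (galAdicCompletionMap (L := L) (IsCMField.complexConj L) hw) ((StdForm.antidiagonal 2).over (w.1.adicCompletion L)))
                (unitaryInt (galAdicCompletionMap (L := L) (IsCMField.complexConj L) hw) ((StdForm.antidiagonal 2).over (w.1.adicCompletion L)))),
            (∀ z : ℂˣ,
            UnitaryGroup.unitaryHeckeEigencharacterAdic (IsCMField.complexConj L) (IsCMField.complexConj_ne_one L) v w hw hv ![z, 1] φH =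
              UnitaryGroup.unitaryHeckeEigencharacterAdic (IsCMField.complexConj L) (IsCMField.complexConj_ne_one L) v w hw hv ![-z, 1, 1] φ) →
              ∀ γH : ((UnitaryGroup.cmDatum L 2 (Matrix.of fun i j : Fin 2 => if i.val + j.val + 1 = 2 then (1 : L) else 0)).Local v ×
        (UnitaryGroup.cmDatum L 1 (Matrix.of fun i j : Fin 1 => if i.val + j.val + 1 = 1 then (1 : L) else 0)).Local v),
                IsLocalGRegular L v γH → IsEllTwoCell γH →
                  stableOrbitalIntegralRel (IsLocalStablyConjH L v) mH
                    (fun h : (UnitaryGroup.cmDatum L 2 (Matrix.of fun i j : Fin 2 => if i.val + j.val + 1 = 2 then (1 : L) else 0)).Local v ×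
        (UnitaryGroup.cmDatum L 1 (Matrix.of fun i j : Fin 1 => if i.val + j.val + 1 = 1 then (1 : L) else 0)).Local v =>
              (heckeAlgebra.toVector (unitaryInt (galAdicCompletionMap (L := L) (IsCMField.complexConj L) hw) ((StdForm.antidiagonal 2).over (w.1.adicCompletion L))) φH).coeff
                (((e₂ h.1 : ↥(unitaryGroupOfForm (galAdicCompletionMap (L := L) (IsCMField.complexConj L) hw) ((StdForm.antidiagonal 2).over (w.1.adicCompletion L))))) : ↥(unitaryGroupOfForm (galAdicCompletionMap (L := L) (IsCMField.complexConj L) hw) ((StdForm.antidiagonal 2).over (w.1.adicCompletion L))) ⧸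
                  unitaryInt (galAdicCompletionMap (L := L) (IsCMField.complexConj L) hw) ((StdForm.antidiagonal 2).over (w.1.adicCompletion L)))) γH =
                  ∑ᶠ c : ConjClasses ((UnitaryGroup.cmDatum L 3 H').Local v),
                    ((finExplicitCollection L H' μ (finExplicitDelta_conj_left_all L H' μ) (finExplicitDelta_conj_right_all L H' μ)) v).Δ γH (Quotient.out c) *
                      classOrbitalIntegral mG
                        (fun g : (UnitaryGroup.cmDatum L 3 H').Local v =>
              (heckeAlgebra.toVector (unitaryInt (galAdicCompletionMap (L := L) (IsCMField.complexConj L) hw) ((StdForm.antidiagonal 3).over (w.1.adicCompletion L))) φ).coeff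
                (((eG g : ↥(unitaryGroupOfForm (galAdicCompletionMap (L := L) (IsCMField.complexConj L) hw) ((StdForm.antidiagonal 3).over (w.1.adicCompletion L))))) : ↥(unitaryGroupOfForm (galAdicCompletionMap (L := L) (IsCMField.complexConj L) hw) ((StdForm.antidiagonal 3).over (w.1.adicCompletion L))) ⧸
                  unitaryInt (galAdicCompletionMap (L := L) (IsCMField.complexConj L) hw) ((StdForm.antidiagonal 3).over (w.1.adicCompletion L)))) c) :
    -- CONCLUSION = the body of `HeckeFLAtFrame L H' μ νH νG v w hw hv eG` at `νHv := νH v`, `νGv := νG v` (D :940–:957 ∕ :1047–:1064), `heckeToFun` ∕ `SatakeGraph` unfolded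
        ∀ (eH : (UnitaryGroup.cmDatum L 2 (Matrix.of fun i j : Fin 2 => if i.val + j.val + 1 = 2 then (1 : L) else 0)).Local v ≃ₜ*
            ↥(unitaryGroupOfForm (galAdicCompletionMap (L := L) (IsCMField.complexConj L) hw) ((StdForm.antidiagonal 2).over (w.1.adicCompletion L)))),
          (∀ h : (UnitaryGroup.cmDatum L 2 (Matrix.of fun i j : Fin 2 => if i.val + j.val + 1 = 2 then (1 : L) else 0)).Local v,
            eH h ∈ unitaryInt (galAdicCompletionMap (L := L) (IsCMField.complexConj L) hw) ((StdForm.antidiagonal 2).over (w.1.adicCompletion L)) ↔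
              h ∈ UnitaryGroup.cmLocalIntegralLevel L 2 (Matrix.of fun i j : Fin 2 => if i.val + j.val + 1 = 2 then (1 : L) else 0) v) →
        ∀ (mH : OrbitalMeasureFamily ((UnitaryGroup.cmDatum L 2 (Matrix.of fun i j : Fin 2 => if i.val + j.val + 1 = 2 then (1 : L) else 0)).Local v ×
        (UnitaryGroup.cmDatum L 1 (Matrix.of fun i j : Fin 1 => if i.val + j.val + 1 = 1 then (1 : L) else 0)).Local v))
          (mG : OrbitalMeasureFamily ((UnitaryGroup.cmDatum L 3 H').Local v)),
          mH.IsCanonical (IsLocalGRegular L v) νHv →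
            mG.IsCanonical (fun γ => IsRegularElt (γ.val : GL (Fin 3) (UnitaryGroup.LocalRing L v))) νGv →
              ∀ (φ : heckeAlgebra ℂ ↥(unitaryGroupOfForm (galAdicCompletionMap (L := L) (IsCMField.complexConj L) hw) ((StdForm.antidiagonal 3).over (w.1.adicCompletion L)))
                  (unitaryInt (galAdicCompletionMap (L := L) (IsCMField.complexConj L) hw) ((StdForm.antidiagonal 3).over (w.1.adicCompletion L))))
                (φH : heckeAlgebra ℂ ↥(unitaryGroupOfForm (galAdicCompletionMap (L := L) (IsCMField.complexConj L) hw) ((StdForm.antidiagonal 2).over (w.1.adicCompletion L)))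
                  (unitaryInt (galAdicCompletionMap (L := L) (IsCMField.complexConj L) hw) ((StdForm.antidiagonal 2).over (w.1.adicCompletion L)))),
                (∀ z : ℂˣ,
            UnitaryGroup.unitaryHeckeEigencharacterAdic (IsCMField.complexConj L) (IsCMField.complexConj_ne_one L) v w hw hv ![z, 1] φH =
              UnitaryGroup.unitaryHeckeEigencharacterAdic (IsCMField.complexConj L) (IsCMField.complexConj_ne_one L) v w hw hv ![-z, 1, 1] φ) →
                  IsLocalDeltaTransfer L H' v ((finExplicitCollection L H' μ (finExplicitDelta_conj_left_all L H' μ) (finExplicitDelta_conj_right_all L H' μ)) v) mH mG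
                    (fun h : (UnitaryGroup.cmDatum L 2 (Matrix.of fun i j : Fin 2 => if i.val + j.val + 1 = 2 then (1 : L) else 0)).Local v ×
        (UnitaryGroup.cmDatum L 1 (Matrix.of fun i j : Fin 1 => if i.val + j.val + 1 = 1 then (1 : L) else 0)).Local v =>
              (heckeAlgebra.toVector (unitaryInt (galAdicCompletionMap (L := L) (IsCMField.complexConj L) hw) ((StdForm.antidiagonal 2).over (w.1.adicCompletion L))) φH).coeff
                (((eH h.1 : ↥(unitaryGroupOfForm (galAdicCompletionMap (L := L) (IsCMField.complexConj L) hw) ((StdForm.antidiagonal 2).over (w.1.adicCompletion L))))) : ↥(unitaryGroupOfForm (galAdicCompletionMap (L := L) (IsCMField.complexConj L) hw) ((StdForm.antidiagonal 2).over (w.1.adicCompletion L))) ⧸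
                  unitaryInt (galAdicCompletionMap (L := L) (IsCMField.complexConj L) hw) ((StdForm.antidiagonal 2).over (w.1.adicCompletion L))))
                    (fun g : (UnitaryGroup.cmDatum L 3 H').Local v =>
              (heckeAlgebra.toVector (unitaryInt (galAdicCompletionMap (L := L) (IsCMField.complexConj L) hw) ((StdForm.antidiagonal 3).over (w.1.adicCompletion L))) φ).coeff
                (((eG g : ↥(unitaryGroupOfForm (galAdicCompletionMap (L := L) (IsCMField.complexConj L) hw) ((StdForm.antidiagonal 3).over (w.1.adicCompletion L))))) : ↥(unitaryGroupOfForm (galAdicCompletionMap (L := L) (IsCMField.complexConj L) hw) ((StdForm.antidiagonal 3).over (w.1.adicCompletion L))) ⧸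
                  unitaryInt (galAdicCompletionMap (L := L) (IsCMField.complexConj L) hw) ((StdForm.antidiagonal 3).over (w.1.adicCompletion L)))) := by
  intro eH heH mH mG hmH hmG φ φH hgr γH hreg
  -- «EH-SWAP»: the `H`-side stable orbital integral at `eH` is the one at `e₂` (congruence along `hSWAP`; no rewriting under binders)
  have hF := congrArg (fun F => stableOrbitalIntegralRel (IsLocalStablyConjH L v) mH F γH) (hSWAP eH heH φH)
  -- «CLASSIFY» (as a hypothesis first: `rcases` on the applied term would `generalize` over the large goal)
  have hcl := hCLASSIFY γH hreg
  rcases hcl with hc | hc | hc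
  · have h1 := hHYP mH mG hmH hmG φ φH hgr γH hreg hc
    exact hF.trans h1
  · have h1 := hELL1 mH mG hmH hmG φ φH hgr γH hreg hc
    exact hF.trans h1
  · have h1 := hELL2 mH mG hmH hmG φ φH hgr γH hreg hc
    exact hF.trans h1

end Summit.HodgeConjecture.HodgeConjecture.R90.S6

end
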